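import Summits.BirchSwinnertonDyer.BirchSwinnertonDyer.Theorems.GenusKolyvaginAtTwoGenusPrimitiveSupplyAtTwoTwistingPrimeLocal
import Summits.BirchSwinnertonDyer.BirchSwinnertonDyer.Theorems.GenusKolyvaginAtTwoGenusPrimitiveSupplyAtTwoPrimeHeegnerTwinRowOne
import Literature.NumberTheory.Automorphic.ChebotarevArtinRepHolds
import HarnessLib

/-!
# Route `GenusKolyvaginAtTwo`, crux #2 `GenusPrimitiveSupplyAtTwo` (stmt-BirchSwinnertonDyer-22136):
# MAZUR–RUBIN TWISTING PRIMES AT `2` EXIST — unconditionally (Čebotarev is proved in the tree)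

Width seat `bsd-line-gk2-p4` g7, cell `bsd-f1-sign2`; helper (`--supports stmt-BirchSwinnertonDyer-22136`),
second of two files (ingredients: `…TwistingPrimeLocal.lean`). THEOREMS ONLY: no definition, no named fact,
no `sorry`; no item is closed; BSD is not proved by any of this.

WHY. On the habitat of crux #2 with `#Sel₂(E) = 4` (every WALL-row-1 cell), the supply of a Heegner field
`K = ℚ(√−ℓ)` of DEF `= 1` whose twin `E^{(−ℓ)}` is `2`-Selmer-minimal is, by gk2-p5's
`GenusKolyTwin.natCard_selmerGroup_twin_eq_two_iff_not_strict` (Mazur–Rubin Cor. 3.4 (i)), EXACTLY the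
existence of a prime `ℓ ≡ 7 (mod 8)`, `ℓ ≡ −1 (mod p)` for `p ∣ N`, at which `Sel₂(E)` is NOT strict
(`¬ Sel₂(E) ≤ ker loc_ℓ`). The line memo `Lines/genus-supply-prime-heegner.md` (§1 end) records this as
«the ONE missing print input for SUPPLY″ on row 1 … typing welcome». This file PROVES it instead:

* `exists_twistingPrime` — for `W/ℚ` elliptic, `Δ(W) < 0`, `ρ̄_{W,2}` onto, a complex conjugation `c₀`,
  `0 ≠ x ∈ H¹(ℚ, E[2])`, `m ≥ 1`, `b`: a prime `ℓ > b`, `ℓ ∤ m`, with `m ∣ ℓ + 1`, an arithmetic Frobenius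
  at `ℓ` acting on `E[2]` as `c₀`, and `x ∉ ker (H¹(ℚ, E[2]) → H¹(ℚ_ℓ, E[2]))`.
* `exists_twistingPrime_not_mem_strictLocalKer`, `exists_twistingPrime_not_selmerGroup_le_strictLocalKer` —
  the same in the line's currency: `ℓ ≡ 7 (mod 8)`, `p ∣ N → p ∣ ℓ + 1`, `ℓ ∤ 2N`, and
  `c ∉ MazurRubin2010.strictLocalKer W ℚ_[ℓ] 2`, resp. `¬ W.selmerGroup 2 ≤ MazurRubin2010.strictLocalKer W ℚ_[ℓ] 2`
  whenever `#Sel₂(W) ≠ 1`.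

PROOF (Mazur–Rubin 2010 §§3–4 run with Gross §9 / McCallum §3 at `p = 2` over `ℚ`). Key lemma (companion
file): some `h₀ ∈ Γ_{ℚ(E[2], μ_m)}` has `c₀[x,h₀] ≠ [x,h₀]`. The set `c₀h₀·(𝒩_x ∩ Stab ζ_m) ⊂ Γ_ℚ` is open and
non-empty, so (Čebotarev in the tree's form `absoluteGaloisGroup.frobenius_dense`, fed with the PROVED
`Automorphic.chebotarev_artinRep_holds`) contains an arithmetic Frobenius `γ` at a place `v` outside the finite
set of primes of `m` and primes `≤ b`. Then `γ` inverts `μ_m` (as `c₀` does) and raises it to the `N v = ℓ`-th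
power, so `m ∣ ℓ + 1`; `γ` acts on `E[2]` as the transposition `c₀`, so `γ² ∈ Γ_{ℚ(E[2])} ∩ G_𝔓` with
`[x, γ²] = c₀[x,h₀] + [x,h₀] ≠ 0`, whence `x_v ≠ 0` (easy half of the local criterion); finally
`ℚ_v ≅ ℚ_ℓ` (Mathlib `Rat.HeightOneSpectrum.adicCompletion.padicEquiv`). Axioms: propext, Classical.choice,
Quot.sound — in particular NO named fact: the twisting-prime supply of the line is unconditional.

Not here: the Selmer-rank bookkeeping (Mazur–Rubin Prop. 3.3 / Cor. 3.4 (i) remain the named facts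
`prop33_rat` / `cor34i_singleton_rat` consumed by gk2-p5's files); the simultaneous control of `Sel₂(E)` and
`Sel₂(E^{d})` at a Kolyvagin prime (the LEVEL LAW's prime-level supply) — same mechanism, not typed here.

References: [MazurRubin2010] Prop. 3.3, Cor. 3.4, Lemma 3.5; [GrossLMS1991] §9; [McCallumLMS1991] §3;
[SerreAbelianLadic1968] I §2.2 (Čebotarev, density form).
-/

set_option linter.dupNamespace false -- tree convention: `Summit.BirchSwinnertonDyer.BirchSwinnertonDyer.Theorems` (summit = sub-problem)
set_option autoImplicit false

noncomputable section

open scoped Classical Pointwise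

namespace Summit.BirchSwinnertonDyer.BirchSwinnertonDyer.Theorems.GenusKolyTwistingPrime

open WeierstrassCurve NumberField IsDedekindDomain Field
open Literature.NumberTheory.GaloisRepresentations Literature.NumberTheory.EllipticCurves
open Literature.NumberTheory

/-! ## §4 The twisting primes -/

section Main

variable (W : WeierstrassCurve ℚ) [W.IsElliptic]

/-- **MAZUR–RUBIN TWISTING PRIMES AT `2` EXIST (unconditionally).** Let `E = W/ℚ` be elliptic with
`Δ(W) < 0` and `ρ̄_{E,2} : Γ_ℚ → Aut E[2]` onto, `c₀` a complex conjugation, `0 ≠ x ∈ H¹(ℚ, E[2])`,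
`m ≥ 1` and `b` a bound. Then there is a prime `ℓ > b`, `ℓ ∤ m`, with
* `m ∣ ℓ + 1` (so, for `8N ∣ m`: `ℓ ≡ 7 (mod 8)` and `ℓ ≡ −1 (mod p)` for every `p ∣ N` — every
  prime of `N` and `2` split in the prime Heegner field `ℚ(√−ℓ)`),
* an arithmetic Frobenius at `ℓ` acting on `E[2]` as `c₀` (a transposition: `#E(ℚ_ℓ)[2] = 2`), and
* **`x_ℓ ≠ 0` in `H¹(ℚ_ℓ, E[2])`**: `x ∉ ker (H¹(ℚ, E[2]) → H¹(ℚ_ℓ, E[2]))` (`torsionLocalKer` =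
  Mazur–Rubin's strict condition `strictLocalKer`).
Proof (Mazur–Rubin 2010 §§3–4 / Gross 1991 §9, McCallum 1991 §3 at `p = 2` over `ℚ`): by the key
lemma pick `h₀ ∈ Γ_{ℚ(E[2],μ_m)}` with `c₀[x,h₀] ≠ [x,h₀]`; the open set `c₀h₀·(𝒩 ∩ Stab μ_m)` of
`Γ_ℚ` contains a Frobenius `γ` at a place `v ∤ m`, `v > b` (Čebotarev: `frobenius_dense`, proved in
the tree); `γ` inverts `μ_m`, so `m ∣ ℓ + 1`; `γ² ∈ Γ_{ℚ(E[2])} ∩ G_𝔓` has `[x, γ²] = c₀[x,h₀] +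
[x,h₀] ≠ 0`, so `x_v ≠ 0` by the easy half of the local criterion; finally `ℚ_v ≅ ℚ_ℓ`.
[cite: MazurRubin2010, Prop. 3.3 and Lemma 3.5 (twisting primes via Čebotarev)] [cite: GrossLMS1991, §9 Prop. 9.6]
[cite: McCallumLMS1991, §3 Cor. 3.2] -/
theorem exists_twistingPrime (hsurj : W.HasSurjectiveModNGaloisRep 2) (hΔ : W.Δ < 0)
    {c₀ : absoluteGaloisGroup ℚ} (hc₀ : IsComplexConjugation (Rat.castHom ℝ) c₀)
    {x : galH1Torsion W (2 : ℤ)} (hx : x ≠ 0) {m : ℕ} (hm : m ≠ 0) (b : ℕ) :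
    ∃ ℓ : ℕ, ∃ _ : Fact ℓ.Prime, b < ℓ ∧ ¬ ℓ ∣ m ∧ m ∣ ℓ + 1 ∧
      (∃ (v : HeightOneSpectrum (𝓞 ℚ)) (𝔓 : Ideal (absIntegers (𝓞 ℚ) ℚ))
          (F : absoluteGaloisGroup ℚ), (ℓ : 𝓞 ℚ) ∈ v.asIdeal ∧ 𝔓 ∈ v.primesAbove ∧
          IsArithFrobAt (𝓞 ℚ) F 𝔓 ∧ ∀ P : geomTorsion W (2 : ℤ), F • P = c₀ • P) ∧
      x ∉ W.torsionLocalKer ℚ_[ℓ] (2 : ℤ) := by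
  classical
  haveI : NeZero m := ⟨hm⟩
  have hn0 : (2 : ℤ) ≠ 0 := two_ne_zero
  -- a primitive `m`-th root of unity in `ℚ̄`
  have hq0 : ((m : ℕ) : AlgebraicClosure ℚ) ≠ 0 := by exact_mod_cast hm
  haveI : NeZero ((m : ℕ) : AlgebraicClosure ℚ) := ⟨hq0⟩
  obtain ⟨ζ, hζ⟩ := IsAlgClosed.exists_root (Polynomial.cyclotomic m (AlgebraicClosure ℚ))
    (Polynomial.degree_cyclotomic_pos m _ (Nat.pos_of_ne_zero hm)).ne'
  have hprim : IsPrimitiveRoot ζ m := Polynomial.isRoot_cyclotomic_iff.mp hζ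
  -- ### the key lemma: `h₀ ∈ Γ_{ℚ(E[2])}` fixing `ζ` with `c₀ [x, h₀] ≠ [x, h₀]`
  obtain ⟨h₀, hh₀T, hh₀ζ, hh₀v⟩ := exists_torsionFixing_smul_h1Eval_ne W hsurj hΔ hc₀ hx hprim
  -- ### the finite exceptional set of places of `ℚ`
  set B : Finset ℕ := m.primeFactors ∪ Finset.range (b + 1) with hB
  set S : Set (HeightOneSpectrum (𝓞 ℚ)) := {v | ∃ q ∈ B, q.Prime ∧ (q : 𝓞 ℚ) ∈ v.asIdeal}
    with hS
  have hSfin : S.Finite := by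
    have : S ⊆ ⋃ q ∈ (B.filter Nat.Prime), {v | (q : 𝓞 ℚ) ∈ v.asIdeal} := by
      intro v ⟨q, hqB, hq, hqv⟩
      simp only [Set.mem_iUnion, Finset.mem_filter]
      exact ⟨q, ⟨hqB, hq⟩, hqv⟩
    refine Set.Finite.subset (Set.Finite.biUnion (Finset.finite_toSet _) fun q hq ↦ ?_) this
    rw [Finset.coe_filter, Set.mem_setOf_eq] at hq
    have hsub : {v : HeightOneSpectrum (𝓞 ℚ) | (q : 𝓞 ℚ) ∈ v.asIdeal}.Subsingleton :=
      fun v hv v' hv' ↦ HeightOneSpectrum.eq_of_natCast_mem_rat hq.2 hv hv'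
    exact hsub.finite
  -- ### Čebotarev: a Frobenius in the open set `c₀ h₀ · (𝒩 ∩ Stab ζ)`
  set 𝒩 := evalKer W (2 : ℤ) (fun _ : Unit ↦ x) with h𝒩
  have h𝒩open : IsOpen (𝒩 : Set (absoluteGaloisGroup ℚ)) :=
    isOpen_evalKer W _ _ (isOpen_torsionFixing W hn0)
  set A : Subgroup (absoluteGaloisGroup ℚ) := MulAction.stabilizer (absoluteGaloisGroup ℚ) ζ with hA
  have hAopen : IsOpen (A : Set (absoluteGaloisGroup ℚ)) := by
    haveI : FiniteDimensional ℚ (IntermediateField.adjoin ℚ {ζ}) :=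
      IntermediateField.adjoin.finiteDimensional
        ((AlgebraicClosure.isAlgebraic ℚ).isAlgebraic ζ).isIntegral
    refine Subgroup.isOpen_mono (H₁ := (IntermediateField.adjoin ℚ {ζ}).fixingSubgroup) ?_
      (IntermediateField.fixingSubgroup_isOpen _)
    intro σ hσ
    rw [IntermediateField.mem_fixingSubgroup_iff] at hσ
    exact hσ ζ (IntermediateField.mem_adjoin_simple_self ℚ ζ)
  set U : Set (absoluteGaloisGroup ℚ) := (𝒩 : Set _) ∩ (A : Set _) with hU
  have hUopen : IsOpen U := h𝒩open.inter hAopen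
  set O : Set (absoluteGaloisGroup ℚ) := (fun γ ↦ c₀ * h₀ * γ) '' U with hO
  have hOopen : IsOpen O := (Homeomorph.mulLeft (c₀ * h₀)).isOpenMap _ hUopen
  have hOne : O.Nonempty := ⟨c₀ * h₀ * 1, 1, ⟨𝒩.one_mem, A.one_mem⟩, rfl⟩
  obtain ⟨γ, hγO, v, hvS, 𝔓₀, h𝔓₀, hγ⟩ :=
    (absoluteGaloisGroup.frobenius_dense Automorphic.chebotarev_artinRep_holds ℚ S hSfin
      ).inter_open_nonempty O hOopen hOne
  obtain ⟨u, ⟨hu𝒩, huA⟩, rfl⟩ := hγO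
  have huT : u ∈ torsionFixing W (2 : ℤ) := hu𝒩.1
  have hux : h1Eval W (2 : ℤ) x u = 0 := hu𝒩.2 ()
  have huζ : u • ζ = ζ := huA
  set t := h₀ * u with ht
  have htT : t ∈ torsionFixing W (2 : ℤ) := mul_mem hh₀T huT
  have hγt : c₀ * h₀ * u = c₀ * t := by rw [ht, mul_assoc]
  -- ### the rational prime `ℓ` under `v` (Mathlib's generator of `v ∩ ℤ`) and `ℚ_v ≅ ℚ_ℓ`
  set ℓ : ℕ := (Rat.HeightOneSpectrum.primesEquiv (R := 𝓞 ℚ) v : ℕ) with hℓdef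
  have hℓ : ℓ.Prime := (Rat.HeightOneSpectrum.primesEquiv (R := 𝓞 ℚ) v).2
  haveI hℓF : Fact ℓ.Prime := ⟨hℓ⟩
  have hℓv : (ℓ : 𝓞 ℚ) ∈ v.asIdeal := by
    have h := (Rat.HeightOneSpectrum.natGenerator_dvd_iff (R := 𝓞 ℚ) v (n := ℓ)).mp dvd_rfl
    rw [Ideal.mem_map_iff_of_surjective _ (Rat.IsIntegralClosure.intEquiv (𝓞 ℚ)).surjective] at h
    obtain ⟨y, hy, hyℓ⟩ := h
    have : y = (ℓ : 𝓞 ℚ) := (Rat.IsIntegralClosure.intEquiv (𝓞 ℚ)).injective (by rw [hyℓ, map_natCast])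
    rwa [this] at hy
  haveI : CharZero (v.adicCompletion ℚ) :=
    charZero_of_injective_algebraMap (algebraMap ℚ (v.adicCompletion ℚ)).injective
  set θ : v.adicCompletion ℚ ≃+* ℚ_[ℓ] :=
    RingEquivClass.toRingEquiv (Rat.HeightOneSpectrum.adicCompletion.padicEquiv (R := 𝓞 ℚ) v)
    with hθ
  have hℓB : ℓ ∉ B := fun h ↦ hvS ⟨ℓ, h, hℓ, hℓv⟩
  simp only [hB, Finset.mem_union, Nat.mem_primeFactors, Finset.mem_range, not_or] at hℓB
  obtain ⟨hℓm', hℓb⟩ := hℓB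
  have hℓm : ¬ ℓ ∣ m := fun h ↦ hℓm' ⟨hℓ, h, hm⟩
  have hbℓ : b < ℓ := by omega
  -- ### `m ∣ ℓ + 1`: the Frobenius inverts `ζ` (as `c₀` does) and raises it to the `ℓ`-th power
  have hmv : (m : 𝓞 ℚ) ∉ v.asIdeal := natCast_not_mem_of_not_dvd hℓ hℓv hℓm
  have h1 : (c₀ * h₀ * u) • ζ = ζ⁻¹ := by
    rw [mul_smul, mul_smul, huζ, hh₀ζ, RatClosure.smul_eq_inv_of_pow_eq_one hc₀ hm hprim.pow_eq_one]
  have h2 : (c₀ * h₀ * u) • ζ = ζ ^ v.residueCard :=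
    smul_eq_pow_residueCard_of_isArithFrobAt_of_pow_eq_one hmv h𝔓₀ hγ hprim.pow_eq_one
  rw [residueCard_eq_of_natCast_mem_rat hℓ hℓv, h1] at h2
  have hζ0 : ζ ≠ 0 := hprim.ne_zero hm
  have hζ1 : ζ ^ (ℓ + 1) = 1 := by rw [pow_succ, ← h2, inv_mul_cancel₀ hζ0]
  have hmdvd : m ∣ ℓ + 1 := (hprim.pow_eq_one_iff_dvd (ℓ + 1)).mp hζ1
  -- ### the Frobenius acts on `E[2]` as `c₀`
  have hFE : ∀ P : geomTorsion W (2 : ℤ), (c₀ * h₀ * u) • P = c₀ • P := fun P ↦ by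
    rw [hγt, mul_smul, smul_eq_of_mem_torsionFixing W _ htT]
  -- ### `[x, γ²] = c₀ [x, h₀] + [x, h₀] ≠ 0`
  have hsq : c₀ * c₀ = 1 := by have h := hc₀.sq_eq_one; rwa [sq] at h
  have hcinv : c₀⁻¹ = c₀ := inv_eq_of_mul_eq_one_right hsq
  have hγγ : (c₀ * h₀ * u) * (c₀ * h₀ * u) = (c₀ * t * c₀⁻¹) * t := by
    rw [hγt, hcinv]; group
  have hconjT : c₀ * t * c₀⁻¹ ∈ torsionFixing W (2 : ℤ) := (torsionFixing_normal W _).conj_mem t htT c₀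
  have hγγT : (c₀ * h₀ * u) * (c₀ * h₀ * u) ∈ torsionFixing W (2 : ℤ) := by
    rw [hγγ]; exact mul_mem hconjT htT
  have hval : h1Eval W (2 : ℤ) x ((c₀ * h₀ * u) * (c₀ * h₀ * u)) ≠ 0 := by
    rw [hγγ, h1Eval_mul W _ x hconjT, h1Eval_conj W _ x c₀ htT, ht, h1Eval_mul W _ x hh₀T, hux,
      add_zero]
    intro h0
    apply hh₀v
    have h2v : h1Eval W (2 : ℤ) x h₀ + h1Eval W (2 : ℤ) x h₀ = 0 := by
      rw [← two_nsmul]; exact AddSubgroup.torsionBy.nsmul _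
    rw [eq_neg_of_add_eq_zero_left h0, neg_eq_of_add_eq_zero_left h2v]
  -- ### the local criterion at `v`, then transport to `ℚ_ℓ`
  have hloc := not_mem_torsionLocalKer_of_h1Eval_sq_ne_zero W (n := 2) two_ne_zero h𝔓₀ hγ hγγT hval
  refine ⟨ℓ, hℓF, hbℓ, hℓm, hmdvd, ⟨v, 𝔓₀, c₀ * h₀ * u, hℓv, h𝔓₀, hγ, hFE⟩, fun hx' ↦ hloc ?_⟩
  exact (mem_torsionLocalKer_padic_iff W θ (2 : ℤ) x).mp hx'

end Main

/-! ## §5 Corollaries in the currency of the line (`MazurRubin2010.strictLocalKer`, `Sel₂`) -/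

section Corollaries

variable (W : WeierstrassCurve ℚ) [W.IsElliptic]

omit [W.IsElliptic] in
/-- `MazurRubin2010.strictLocalKer W E n` (the MR file's carrier for `ker loc_v`) IS the tree's
`torsionLocalKer W E n` (definitional). [cite: MazurRubin2010, Def. 3.1 (DASH copy p0008 L6–30)] -/
theorem strictLocalKer_eq_torsionLocalKer (E : Type) [Field E] [Algebra ℚ E] (n : ℤ) :
    MazurRubin2010.strictLocalKer W E n = W.torsionLocalKer E n := rfl

/-- **Twisting primes for a Selmer class, Heegner-compatible form** (the «one missing print input
for SUPPLY″ on WALL row 1» of the line `genus-supply`, memo `Lines/genus-supply-prime-heegner.md`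
§1 end, as a THEOREM): for `W/ℚ` elliptic with `Δ(W) < 0` and `ρ̄_{W,2}` onto, a non-zero class
`c ∈ H¹(ℚ, E[2])`, any `N ≥ 1` and any bound `b`, there is a prime `ℓ > b` with `ℓ ∤ 2N`,
`ℓ ≡ 7 (mod 8)`, `p ∣ ℓ + 1` for every `p ∣ N` (so every prime of `N`, and `2`, split in
`ℚ(√−ℓ)`, which is then a prime Heegner field of DEF `1` for level `N`), and
`c ∉ MazurRubin2010.strictLocalKer W ℚ_[ℓ] 2` (`loc_ℓ c ≠ 0`).
[cite: MazurRubin2010, Prop. 3.3, Cor. 3.4 (i) and Lemma 3.5] [cite: GrossLMS1991, §9 Prop. 9.6] -/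
theorem exists_twistingPrime_not_mem_strictLocalKer (hsurj : W.HasSurjectiveModNGaloisRep 2)
    (hΔ : W.Δ < 0) {c : galH1Torsion W (2 : ℤ)} (hc : c ≠ 0) {N : ℕ} (hN : N ≠ 0) (b : ℕ) :
    ∃ ℓ : ℕ, ∃ _ : Fact ℓ.Prime, b < ℓ ∧ ¬ ℓ ∣ 2 * N ∧ ℓ % 8 = 7 ∧ (∀ p : ℕ, p ∣ N → p ∣ ℓ + 1) ∧
      c ∉ MazurRubin2010.strictLocalKer W ℚ_[ℓ] (2 : ℤ) := by
  obtain ⟨c₀, hc₀⟩ := exists_isComplexConjugation (Rat.castHom ℝ)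
  have hm : 8 * N ≠ 0 := by omega
  obtain ⟨ℓ, hℓF, hbℓ, hℓm, hmdvd, -, hloc⟩ := exists_twistingPrime W hsurj hΔ hc₀ hc hm b
  refine ⟨ℓ, hℓF, hbℓ, fun h ↦ hℓm (h.trans ⟨4, by ring⟩), ?_, fun p hp ↦ ?_, hloc⟩
  · have h8 : 8 ∣ ℓ + 1 := (Dvd.intro N rfl).trans hmdvd
    omega
  · exact (Dvd.dvd.mul_left hp 8).trans hmdvd

/-- **SUPPLY″-Selmer's missing input, discharged: for `Sel₂(W) ≠ 0` there are twisting primes at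
which `Sel₂(W)` is NOT strict.** For `W/ℚ` elliptic with `Δ(W) < 0`, `ρ̄_{W,2}` onto and
`#Sel₂(W) ≠ 1`, any `N ≥ 1` (e.g. the conductor) and any bound `b`: a prime `ℓ > b`, `ℓ ∤ 2N`,
`ℓ ≡ 7 (mod 8)`, `p ∣ ℓ + 1` for all `p ∣ N`, with `¬ Sel₂(W) ≤ ker loc_ℓ` — the hypothesis of
`GenusKolyTwin.natCard_selmerGroup_twin_eq_two_iff_not_strict` (gk2-p5, p607617) at the prime of the
prime Heegner field `ℚ(√−ℓ)`; with it the DEF `= 1` Heegner field with a `2`-Selmer-minimal twin on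
the habitat `#Sel₂(W) = 4` exists beyond every bound (modulo only `MazurRubin2010.cor34i_singleton_rat`).
Unconditional (Čebotarev: `Automorphic.chebotarev_artinRep_holds`). BSD is not proved by this.
[cite: MazurRubin2010, Prop. 3.3, Cor. 3.4 (i) and Lemma 3.5] [cite: GrossLMS1991, §9 Prop. 9.6] -/
theorem exists_twistingPrime_not_selmerGroup_le_strictLocalKer
    (hsurj : W.HasSurjectiveModNGaloisRep 2) (hΔ : W.Δ < 0)
    (hSel : Nat.card (W.selmerGroup 2) ≠ 1) {N : ℕ} (hN : N ≠ 0) (b : ℕ) :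
    ∃ ℓ : ℕ, ∃ _ : Fact ℓ.Prime, b < ℓ ∧ ¬ ℓ ∣ 2 * N ∧ ℓ % 8 = 7 ∧ (∀ p : ℕ, p ∣ N → p ∣ ℓ + 1) ∧
      ¬ W.selmerGroup 2 ≤ MazurRubin2010.strictLocalKer W ℚ_[ℓ] 2 := by
  have hne : ∃ c ∈ W.selmerGroup 2, c ≠ 0 := by
    by_contra h
    push Not at h
    apply hSel
    rw [(AddSubgroup.eq_bot_iff_forall _).mpr h, AddSubgroup.card_bot]
  obtain ⟨c, hcS, hc0⟩ := hne
  obtain ⟨ℓ, hℓF, hbℓ, hℓN, hℓ8, hℓp, hloc⟩ :=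
    exists_twistingPrime_not_mem_strictLocalKer W hsurj hΔ hc0 hN b
  exact ⟨ℓ, hℓF, hbℓ, hℓN, hℓ8, hℓp, fun hle ↦ hloc (hle hcS)⟩

end Corollaries

/-! ## §6 Composition with gk2-p5's `supply_DEF1_of_not_strict_prime`: SUPPLY″-Selmer on WALL row 1,
modulo only the print fact `MazurRubin2010.cor34i_singleton_rat` -/

section RowOne

variable (W : WeierstrassCurve ℚ) [W.IsElliptic] [W.IsGloballyMinimal]

/-- **SUPPLY″-Selmer on WALL row 1, beyond every bound, modulo Mazur–Rubin Cor. 3.4 (i) ONLY.** For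
`W/ℚ` globally minimal elliptic with `Δ(W) < 0`, `ρ̄_{W,2}` onto and `#Sel₂(W) = 4` (= every habitat cell
of WALL row 1, `s_E = 2`), and every bound `b`: there is a prime `ℓ > b` (a twisting prime of
`exists_twistingPrime_not_selmerGroup_le_strictLocalKer` for `N = N_W`) such that `K = ℚ(√−ℓ)` carries
every K-clause of crux 22136 (imaginary quadratic, `d_K = −ℓ` odd `≠ −3`, Heegner for `N_W`, the two
non-square clauses), `2` splits in `K`, DEF(W,K) `= 1` (exactly one root of the `2`-division cubic mod `ℓ`),
and the twist has a GLOBALLY MINIMAL model `Wd ≅ W^{(−ℓ)}` with `#Sel₂(Wd) = 2` — gk2-p5's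
`GenusKolyTwin.supply_DEF1_of_not_strict_prime` (p609xxx, `…PrimeHeegnerTwinRowOne`) fed with the twisting
prime proved here. The Čebotarev input is a THEOREM; the only named fact left is
`MazurRubin2010.cor34i_singleton_rat` (PRINT). (The twin's analytic rank `1` is the `2`-converse's business
and is not asserted.) BSD is not proved by this. [cite: MazurRubin2010, Cor. 3.4 (i) with Def. 3.1]
[cite: GrossLMS1991, §1 (p. 235)] -/
theorem supply_DEF1_minimalTwin_rowOne_of_cor34i (h34 : MazurRubin2010.cor34i_singleton_rat)
    (hΔ : W.Δ < 0) (hsurj : W.HasSurjectiveModNGaloisRep 2) (h4 : Nat.card (W.selmerGroup 2) = 4)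
    (b : ℕ) :
    ∃ (ℓ : ℕ), ℓ.Prime ∧ b < ℓ ∧ ℓ % 8 = 7 ∧ ¬ ℓ ∣ 2 * W.conductorNorm ℤ ∧
      ∃ (K : Type) (_ : Field K) (_ : NumberField K), IsImaginaryQuadratic K ∧ discr K = -(ℓ : ℤ) ∧
        Odd (discr K) ∧ discr K ≠ -3 ∧ SatisfiesHeegnerHypothesis (W.conductorNorm ℤ) K ∧
        ¬ IsSquare ((discr K : ℚ) * -|W.Δ|) ∧ ¬ IsSquare ((discr K : ℚ) * (-(2 * |W.Δ|))) ∧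
        ((Ideal.span {(2 : ℤ)}).primesOver (𝓞 K)).ncard = 2 ∧
        (∃! x : ZMod ℓ, 4 * x ^ 3 + ((integralModelInt W).b₂ : ZMod ℓ) * x ^ 2 +
          2 * ((integralModelInt W).b₄ : ZMod ℓ) * x + ((integralModelInt W).b₆ : ZMod ℓ) = 0) ∧
        ∃ (Wd : WeierstrassCurve ℚ) (_ : Wd.IsElliptic) (_ : Wd.IsGloballyMinimal),
          (∃ C : VariableChange ℚ, C • W.quadraticTwist (discr K : ℚ) = Wd) ∧
          Nat.card (Wd.selmerGroup 2) = 2 := by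
  have hN : W.conductorNorm ℤ ≠ 0 := (W.conductorNorm_pos_holds).ne'
  have hSel : Nat.card (W.selmerGroup 2) ≠ 1 := by rw [h4]; norm_num
  obtain ⟨ℓ, hℓF, hbℓ, hℓN, hℓ8, hℓp, hns⟩ :=
    exists_twistingPrime_not_selmerGroup_le_strictLocalKer W hsurj hΔ hSel hN b
  have hℓ : ℓ.Prime := hℓF.out
  have hℓN' : ∀ p : ℕ, p.Prime → p ∣ W.conductorNorm ℤ → p ≠ 2 → (ℓ : ZMod p) = -1 := by
    intro p _ hp _
    have h : ((ℓ + 1 : ℕ) : ZMod p) = 0 := (ZMod.natCast_eq_zero_iff _ _).mpr (hℓp p hp)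
    rw [Nat.cast_add, Nat.cast_one] at h
    exact eq_neg_of_add_eq_zero_left h
  obtain ⟨K, _, _, hK, hd, hodd, hd3, hH, hsq1, hsq2, h2K, hDEF, Wd, _, _, hWd, hSelWd⟩ :=
    GenusKolyTwin.supply_DEF1_of_not_strict_prime W h34 hΔ h4 hℓ8 hℓN' hns
  exact ⟨ℓ, hℓ, hbℓ, hℓ8, hℓN, K, inferInstance, inferInstance, hK, hd, hodd, hd3, hH, hsq1, hsq2, h2K,
    hDEF, Wd, inferInstance, inferInstance, hWd, hSelWd⟩

end RowOne

end Summit.BirchSwinnertonDyer.BirchSwinnertonDyer.Theorems.GenusKolyTwistingPrime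

end
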